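import Mathlib
import Summits.Ventures.PercRepro2.UnionRowMech2
import Summits.Ventures.PercRepro2.UnionRowMech3
import Summits.Ventures.PercRepro2.UnionRowMech4

/-!
# The two-status union row from conditional positive association — the double exclusion closed
(blind cell PercRepro2, mine-1 g40; proofs/MINE1-UNIONROW2.md §8)

The four remaining cases of the residual pattern `(S, T) ∈ A ∩ B`, `(T, S) ∉ A ∪ B` for
`A = resUp cA ⊆ B = resUp cB`: (H) `cA = 3`, `cB ≥ 1` (`A = {u = S}`, `(N, T) ∉ B`; one instance
of `hRu` on `{u = S}` and `{u ≠ T, v ≥ cB}`) and (K) `(cA, cB) = (3, 0)` (`A = {u = S}`,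
`B = {u ≠ T}`; one instance each of `hRu` and `hR′`). `residual_core` assembles the ten cases,
THEOREM `residual_ii` is the pattern for arbitrary up-sets (the case `cA < cB` by the symmetry
of the row in `A, B`).

The mirror pattern `(T, S) ∈ A ∩ B`, `(S, T) ∉ A ∪ B` is `residual_ii` for the transposed law
`M ∘ Prod.swap` and the transposed up-sets (the transposition exchanges `(S, T)` with `(T, S)`,
`{u ≠ T}` with `{v ≠ T}`, `{u ≠ S}` with `{v ≠ S}`): THEOREM `residual_iii`, from positive
association of up-sets inside `{v ≠ T}` (`t ↮ {s, v}`) and of down-sets inside `{v ≠ S}`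
(`s ↮ {t, v}`). With `UnionRowMech2.double_exclusion_nonneg` for the other fourteen membership
patterns this gives THEOREM `double_exclusion_nonneg_all`: the double-exclusion union row of
row 2′CON-U (`X = Y = {u, v}`) for ALL up-sets `A, B`, from the seven positive-association
hypotheses alone — the residual hypothesis of `double_exclusion_nonneg` is gone.
-/

namespace Summit.Ventures.PercRepro2

namespace UnionRowMech

open Finset

variable {M : Grid → ℝ}

/-- The residual pattern (ii) for `(cA, cB) = (3, 1)`. -/
lemma residual_case_3_1 (hM : ∀ k, 0 ≤ M k)
    (hRu : ∀ A B : Finset Grid, IsUp A → IsUp B → A ⊆ Ru → B ⊆ Ru →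
      mass M A * mass M B ≤ mass M (A ∩ B) * mass M Ru)
    :
    0 ≤ total M * (total M * mass M (resUp 3) - mass M (resUp 3) * mass M (resUp 1)) -
      M ST * (total M - mass M (resUp 3)) * (total M - mass M (resUp 1)) -
      M TS * mass M (resUp 3) * mass M (resUp 1) := by
  obtain ⟨h00, h01, h02, h10, h11, h12, h20, h21, h22⟩ := cells_nonneg hM
  obtain ⟨hPQ, hQZ, -, hσ'Q⟩ := resUp_facts hM (cA := 3) (cB := 1) (by norm_num) (by norm_num)
  have hP := mass_nonneg hM (resUp 3)
  -- mechanism (H)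
  have e := hRu _ _ (isUp_resUp 3 (by norm_num)) (isUp_Cset 1 (by norm_num))
    (resUp_subset_Ru 3) (Cset_subset_Ru 1)
  rw [mass_resUp_3, mass_Cset_1, mass_inter_H_1, mass_Ru_expand] at e
  refine patH hP hPQ hQZ hσ'Q ?_
  rw [mass_resUp_3, mass_resUp_1, total_expand]
  unfold ST
  have hp1 : (M (2,1) + M (2,2)) * (M (1,0) + M (1,1) + M (1,2)) ≤ (M (2,1) + M (2,2)) * (M (1,0) + M (1,1) + M (1,2)) :=
    mul_le_mul_of_nonneg_right (by linarith) (by linarith)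
  have hp2 : 0 ≤ (M (2,1) + M (2,2)) * (M (0,0) + M (0,1) + M (0,2)) := mul_nonneg (by linarith) (by linarith)
  nlinarith [e, hp1, hp2]

/-- The residual pattern (ii) for `(cA, cB) = (3, 2)`. -/
lemma residual_case_3_2 (hM : ∀ k, 0 ≤ M k)
    (hRu : ∀ A B : Finset Grid, IsUp A → IsUp B → A ⊆ Ru → B ⊆ Ru →
      mass M A * mass M B ≤ mass M (A ∩ B) * mass M Ru)
    :
    0 ≤ total M * (total M * mass M (resUp 3) - mass M (resUp 3) * mass M (resUp 2)) -
      M ST * (total M - mass M (resUp 3)) * (total M - mass M (resUp 2)) -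
      M TS * mass M (resUp 3) * mass M (resUp 2) := by
  obtain ⟨h00, h01, h02, h10, h11, h12, h20, h21, h22⟩ := cells_nonneg hM
  obtain ⟨hPQ, hQZ, -, hσ'Q⟩ := resUp_facts hM (cA := 3) (cB := 2) (by norm_num) (by norm_num)
  have hP := mass_nonneg hM (resUp 3)
  -- mechanism (H)
  have e := hRu _ _ (isUp_resUp 3 (by norm_num)) (isUp_Cset 2 (by norm_num))
    (resUp_subset_Ru 3) (Cset_subset_Ru 2)
  rw [mass_resUp_3, mass_Cset_2, mass_inter_H_2, mass_Ru_expand] at e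
  refine patH hP hPQ hQZ hσ'Q ?_
  rw [mass_resUp_3, mass_resUp_2, total_expand]
  unfold ST
  have hp1 : (M (2,2)) * (M (1,0) + M (1,1) + M (1,2)) ≤ (M (2,1) + M (2,2)) * (M (1,0) + M (1,1) + M (1,2)) :=
    mul_le_mul_of_nonneg_right (by linarith) (by linarith)
  have hp2 : 0 ≤ (M (2,1) + M (2,2)) * (M (0,0) + M (0,1) + M (0,2)) := mul_nonneg (by linarith) (by linarith)
  nlinarith [e, hp1, hp2]

/-- The residual pattern (ii) for `(cA, cB) = (3, 3)`. -/
lemma residual_case_3_3 (hM : ∀ k, 0 ≤ M k)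
    (hRu : ∀ A B : Finset Grid, IsUp A → IsUp B → A ⊆ Ru → B ⊆ Ru →
      mass M A * mass M B ≤ mass M (A ∩ B) * mass M Ru)
    :
    0 ≤ total M * (total M * mass M (resUp 3) - mass M (resUp 3) * mass M (resUp 3)) -
      M ST * (total M - mass M (resUp 3)) * (total M - mass M (resUp 3)) -
      M TS * mass M (resUp 3) * mass M (resUp 3) := by
  obtain ⟨h00, h01, h02, h10, h11, h12, h20, h21, h22⟩ := cells_nonneg hM
  obtain ⟨hPQ, hQZ, -, hσ'Q⟩ := resUp_facts hM (cA := 3) (cB := 3) (by norm_num) (by norm_num)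
  have hP := mass_nonneg hM (resUp 3)
  -- mechanism (H)
  have e := hRu _ _ (isUp_resUp 3 (by norm_num)) (isUp_Cset 3 (by norm_num))
    (resUp_subset_Ru 3) (Cset_subset_Ru 3)
  rw [mass_resUp_3, mass_Cset_3, mass_inter_H_3, mass_Ru_expand] at e
  refine patH hP hPQ hQZ hσ'Q ?_
  rw [mass_resUp_3, total_expand]
  unfold ST
  have hp1 : (0) * (M (1,0) + M (1,1) + M (1,2)) ≤ (M (2,1) + M (2,2)) * (M (1,0) + M (1,1) + M (1,2)) :=
    mul_le_mul_of_nonneg_right (by linarith) (by linarith)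
  have hp2 : 0 ≤ (M (2,1) + M (2,2)) * (M (0,0) + M (0,1) + M (0,2)) := mul_nonneg (by linarith) (by linarith)
  nlinarith [e, hp1, hp2]

/-- **The residual pattern (ii) for `A = resUp cA ⊆ B = resUp cB`** (`cB ≤ cA`), from positive
association of up-sets inside `{u ≠ T}` and of down-sets inside `{u ≠ S}`. -/
lemma residual_core (hM : ∀ k, 0 ≤ M k)
    (hRu : ∀ A B : Finset Grid, IsUp A → IsUp B → A ⊆ Ru → B ⊆ Ru →
      mass M A * mass M B ≤ mass M (A ∩ B) * mass M Ru)
    (hR' : ∀ A B : Finset Grid, IsDown A → IsDown B → A ⊆ R' → B ⊆ R' →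
      mass M A * mass M B ≤ mass M (A ∩ B) * mass M R')
    (cA cB : ℕ) (hcA : cA ≤ 3) (hcB : cB ≤ cA) :
    0 ≤ total M * (total M * mass M (resUp cA ∩ resUp cB) - mass M (resUp cA) * mass M (resUp cB)) -
      M ST * (total M - mass M (resUp cA)) * (total M - mass M (resUp cB)) -
      M TS * mass M (resUp cA) * mass M (resUp cB) := by
  have hinter : resUp cA ∩ resUp cB = resUp cA := Finset.inter_eq_left.mpr (resUp_subset_resUp hcB)
  rw [hinter]
  interval_cases cA <;> interval_cases cB
  · exact residual_case_0_0 hM hR'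
  · exact residual_case_1_0 hM hR'
  · exact residual_case_1_1 hM hR'
  · exact residual_case_2_0 hM hR'
  · exact residual_case_2_1 hM hR'
  · exact residual_case_2_2 hM hR'
  · exact residual_case_3_0 hM hRu hR'
  · exact residual_case_3_1 hM hRu
  · exact residual_case_3_2 hM hRu
  · exact residual_case_3_3 hM hRu


/-- The double-exclusion expression is symmetric in `A, B`. -/
lemma double_expr_symm (A B : Finset Grid) :
    total M * (total M * mass M (A ∩ B) - mass M A * mass M B) -
        M ST * (total M * (if ST ∈ A then 1 else 0) - mass M A) *
          (total M * (if ST ∈ B then 1 else 0) - mass M B) -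
        M TS * (total M * (if TS ∈ A then 1 else 0) - mass M A) *
          (total M * (if TS ∈ B then 1 else 0) - mass M B) =
      total M * (total M * mass M (B ∩ A) - mass M B * mass M A) -
        M ST * (total M * (if ST ∈ B then 1 else 0) - mass M B) *
          (total M * (if ST ∈ A then 1 else 0) - mass M A) -
        M TS * (total M * (if TS ∈ B then 1 else 0) - mass M B) *
          (total M * (if TS ∈ A then 1 else 0) - mass M A) := by
  rw [Finset.inter_comm]
  ring

/-- **The residual pattern (ii)**: for up-sets `A, B` with `(S, T) ∈ A ∩ B` and
`(T, S) ∉ A ∪ B`, the double-exclusion row is nonnegative, from positive association of up-sets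
inside `{u ≠ T}` and of down-sets inside `{u ≠ S}`. -/
theorem residual_ii (hM : ∀ k, 0 ≤ M k)
    (hRu : ∀ A B : Finset Grid, IsUp A → IsUp B → A ⊆ Ru → B ⊆ Ru →
      mass M A * mass M B ≤ mass M (A ∩ B) * mass M Ru)
    (hR' : ∀ A B : Finset Grid, IsDown A → IsDown B → A ⊆ R' → B ⊆ R' →
      mass M A * mass M B ≤ mass M (A ∩ B) * mass M R')
    {A B : Finset Grid} (hA : IsUp A) (hB : IsUp B)
    (h1A : ST ∈ A) (h1B : ST ∈ B) (h2A : TS ∉ A) (h2B : TS ∉ B) :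
    0 ≤ total M * (total M * mass M (A ∩ B) - mass M A * mass M B) -
      M ST * (total M * (if ST ∈ A then 1 else 0) - mass M A) *
        (total M * (if ST ∈ B then 1 else 0) - mass M B) -
      M TS * (total M * (if TS ∈ A then 1 else 0) - mass M A) *
        (total M * (if TS ∈ B then 1 else 0) - mass M B) := by
  obtain ⟨cA, hcA, rfl⟩ := eq_resUp_of_up hA h1A h2A
  obtain ⟨cB, hcB, rfl⟩ := eq_resUp_of_up hB h1B h2B
  simp only [h1A, h1B, h2A, h2B, if_true, if_false, mul_one, mul_zero, zero_sub]
  rcases Nat.lt_or_ge cA cB with h | h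
  · have := residual_core hM hRu hR' cB cA hcB h.le
    rw [Finset.inter_comm] at this
    nlinarith [this]
  · have := residual_core hM hRu hR' cA cB hcA h
    nlinarith [this]

/-! ### The mirror pattern (iii), by transposing the grid -/

/-- The transposition of the grid, as an embedding. -/
def trE : Grid ↪ Grid := ⟨Prod.swap, Prod.swap_injective⟩

/-- `trE k = (k.2, k.1)`. -/
lemma trE_apply (k : Grid) : trE k = (k.2, k.1) := rfl

/-- Membership in the transpose. -/
lemma mem_map_trE {A : Finset Grid} {k : Grid} : k ∈ A.map trE ↔ (k.2, k.1) ∈ A := by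
  constructor
  · intro h
    obtain ⟨a, ha, rfl⟩ := Finset.mem_map.mp h
    simpa [trE_apply] using ha
  · intro h
    exact Finset.mem_map.mpr ⟨(k.2, k.1), h, rfl⟩

/-- The mass of the transpose under `M` is the mass under `M ∘ Prod.swap`. -/
lemma mass_map_trE (M : Grid → ℝ) (A : Finset Grid) :
    mass M (A.map trE) = mass (M ∘ Prod.swap) A := by
  unfold mass
  rw [Finset.sum_map]
  rfl

/-- The total mass is invariant under transposition. -/
lemma total_swap (M : Grid → ℝ) : total (M ∘ Prod.swap) = total M := by
  unfold total
  exact Fintype.sum_equiv (Equiv.prodComm (Fin 3) (Fin 3)) _ _ (fun _ => rfl)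

/-- The transpose of an up-set is an up-set. -/
lemma isUp_map_trE {A : Finset Grid} (hA : IsUp A) : IsUp (A.map trE) := by
  intro k k' hle hk
  rw [mem_map_trE] at hk ⊢
  exact hA (Prod.swap_le_swap.mpr hle) hk

/-- The transpose of a down-set is a down-set. -/
lemma isDown_map_trE {A : Finset Grid} (hA : IsDown A) : IsDown (A.map trE) := by
  intro k k' hle hk
  rw [mem_map_trE] at hk ⊢
  exact hA (Prod.swap_le_swap.mpr hle) hk

/-- `A ⊆ Ru` iff its transpose lies in `R`. -/
lemma map_trE_subset_R {A : Finset Grid} (h : A ⊆ Ru) : A.map trE ⊆ R := by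
  intro k hk
  rw [mem_map_trE] at hk
  have := h hk
  simp only [Ru, R, Finset.mem_filter, Finset.mem_univ, true_and] at this ⊢
  exact this

/-- `A ⊆ R′` iff its transpose lies in `Rv′`. -/
lemma map_trE_subset_Rv' {A : Finset Grid} (h : A ⊆ R') : A.map trE ⊆ Rv' := by
  intro k hk
  rw [mem_map_trE] at hk
  have := h hk
  simp only [R', Rv', Finset.mem_filter, Finset.mem_univ, true_and] at this ⊢
  exact this

/-- The transpose of `Ru` is `R`. -/
lemma map_trE_Ru : Ru.map trE = R := by decide

/-- The transpose of `R′` is `Rv′`. -/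
lemma map_trE_R' : R'.map trE = Rv' := by decide

/-- **The residual pattern (iii)**: for up-sets `A, B` with `(T, S) ∈ A ∩ B` and
`(S, T) ∉ A ∪ B`, the double-exclusion row is nonnegative, from positive association of up-sets
inside `{v ≠ T}` and of down-sets inside `{v ≠ S}` — the transpose of `residual_ii`. -/
theorem residual_iii (hM : ∀ k, 0 ≤ M k)
    (hR : ∀ A B : Finset Grid, IsUp A → IsUp B → A ⊆ R → B ⊆ R →
      mass M A * mass M B ≤ mass M (A ∩ B) * mass M R)
    (hRv' : ∀ A B : Finset Grid, IsDown A → IsDown B → A ⊆ Rv' → B ⊆ Rv' →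
      mass M A * mass M B ≤ mass M (A ∩ B) * mass M Rv')
    {A B : Finset Grid} (hA : IsUp A) (hB : IsUp B)
    (h1A : TS ∈ A) (h1B : TS ∈ B) (h2A : ST ∉ A) (h2B : ST ∉ B) :
    0 ≤ total M * (total M * mass M (A ∩ B) - mass M A * mass M B) -
      M ST * (total M * (if ST ∈ A then 1 else 0) - mass M A) *
        (total M * (if ST ∈ B then 1 else 0) - mass M B) -
      M TS * (total M * (if TS ∈ A then 1 else 0) - mass M A) *
        (total M * (if TS ∈ B then 1 else 0) - mass M B) := by
  -- the transposed law and sets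
  set M' : Grid → ℝ := M ∘ Prod.swap with hM'
  have hM'0 : ∀ k, 0 ≤ M' k := fun k => hM _
  have hRu' : ∀ A B : Finset Grid, IsUp A → IsUp B → A ⊆ Ru → B ⊆ Ru →
      mass M' A * mass M' B ≤ mass M' (A ∩ B) * mass M' Ru := by
    intro A B hA hB hAR hBR
    have := hR _ _ (isUp_map_trE hA) (isUp_map_trE hB) (map_trE_subset_R hAR)
      (map_trE_subset_R hBR)
    rwa [← Finset.map_inter, mass_map_trE, mass_map_trE, mass_map_trE, ← map_trE_Ru,
      mass_map_trE] at this
  have hR'' : ∀ A B : Finset Grid, IsDown A → IsDown B → A ⊆ R' → B ⊆ R' →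
      mass M' A * mass M' B ≤ mass M' (A ∩ B) * mass M' R' := by
    intro A B hA hB hAR hBR
    have := hRv' _ _ (isDown_map_trE hA) (isDown_map_trE hB) (map_trE_subset_Rv' hAR)
      (map_trE_subset_Rv' hBR)
    rwa [← Finset.map_inter, mass_map_trE, mass_map_trE, mass_map_trE, ← map_trE_R',
      mass_map_trE] at this
  have key := residual_ii hM'0 hRu' hR'' (isUp_map_trE hA) (isUp_map_trE hB)
    (mem_map_trE.mpr h1A) (mem_map_trE.mpr h1B) (fun h => h2A (mem_map_trE.mp h))
    (fun h => h2B (mem_map_trE.mp h))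
  have hMM : M' ∘ Prod.swap = M := by
    ext k
    simp [hM']
  rw [← Finset.map_inter, mass_map_trE, mass_map_trE, mass_map_trE, total_swap, hMM] at key
  simp only [mem_map_trE] at key
  have e1 : M' ST = M TS := rfl
  have e2 : M' TS = M ST := rfl
  have e3 : (ST.2, ST.1) = TS := rfl
  have e4 : (TS.2, TS.1) = ST := rfl
  rw [e1, e2, e3, e4] at key
  simp only [h1A, h1B, h2A, h2B, if_true, if_false, mul_one, mul_zero, zero_sub] at key ⊢
  linarith [key]

/-! ### The double-exclusion row for all up-sets -/

/-- **The double-exclusion union row from conditional positive association, for ALL up-sets**: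
`double_exclusion_nonneg` without its residual hypothesis. -/
theorem double_exclusion_nonneg_all (hM : ∀ k, 0 ≤ M k)
    (hQ : ∀ A B : Finset Grid, IsUp A → IsUp B →
      mass M A * mass M B ≤ mass M (A ∩ B) * total M)
    (hR : ∀ A B : Finset Grid, IsUp A → IsUp B → A ⊆ R → B ⊆ R →
      mass M A * mass M B ≤ mass M (A ∩ B) * mass M R)
    (hR' : ∀ A B : Finset Grid, IsDown A → IsDown B → A ⊆ R' → B ⊆ R' →
      mass M A * mass M B ≤ mass M (A ∩ B) * mass M R')
    (hRu : ∀ A B : Finset Grid, IsUp A → IsUp B → A ⊆ Ru → B ⊆ Ru →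
      mass M A * mass M B ≤ mass M (A ∩ B) * mass M Ru)
    (hRv' : ∀ A B : Finset Grid, IsDown A → IsDown B → A ⊆ Rv' → B ⊆ Rv' →
      mass M A * mass M B ≤ mass M (A ∩ B) * mass M Rv')
    (hR₀ : ∀ A B : Finset Grid, IsUp A → IsUp B → A ⊆ R₀ → B ⊆ R₀ →
      mass M A * mass M B ≤ mass M (A ∩ B) * mass M R₀)
    (hR₀' : ∀ A B : Finset Grid, IsDown A → IsDown B → A ⊆ R₀' → B ⊆ R₀' →
      mass M A * mass M B ≤ mass M (A ∩ B) * mass M R₀')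
    {A B : Finset Grid} (hA : IsUp A) (hB : IsUp B) :
    0 ≤ total M * (total M * mass M (A ∩ B) - mass M A * mass M B) -
      M ST * (total M * (if ST ∈ A then 1 else 0) - mass M A) *
        (total M * (if ST ∈ B then 1 else 0) - mass M B) -
      M TS * (total M * (if TS ∈ A then 1 else 0) - mass M A) *
        (total M * (if TS ∈ B then 1 else 0) - mass M B) := by
  by_cases hres : (ST ∈ A ∧ ST ∈ B ∧ TS ∉ A ∧ TS ∉ B) ∨ (TS ∈ A ∧ TS ∈ B ∧ ST ∉ A ∧ ST ∉ B)
  · rcases hres with ⟨h1, h2, h3, h4⟩ | ⟨h1, h2, h3, h4⟩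
    · exact residual_ii hM hRu hR' hA hB h1 h2 h3 h4
    · exact residual_iii hM hR hRv' hA hB h1 h2 h3 h4
  · exact double_exclusion_nonneg hM hQ hR hR' hRu hRv' hR₀ hR₀' hA hB hres

end UnionRowMech

end Summit.Ventures.PercRepro2
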